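import Literature.AnabelianGeometry.SemiGraphs.EstrangedUniform
import Literature.AnabelianGeometry.SemiGraphs.SubgroupPresentationStabilizers

/-!
# Finite-level estrangement in a coset presentation: two fixed edge classes at one vertex class FOLD or the element is small

Mochizuki, *Semi-graphs of anabelioids*, Publ. RIMS **42** (2006), proof of Thm. 3.7 (iii) p. 41 with the
author's Comments (2020) (6)(b) [cite: MochizukiSemiAnbd2006, Thm 3.7(iii) p.41] ("if `H` fixes two
vertices … joined by a single edge"; "each of the sets `E_{j,i}`, for `i` sufficiently large relative to
`j`, is of cardinality 1"), read at the FINITE levels in the coset presentation of the level trees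
(`SubgroupPresentation.cosetGraph`, cell dictionary T3d: vertices `H_u y K`, edges `M_e y K`, the branch
`β` of `M_e y K` abutting to `H_u s_β y K`; `g` fixes `M_e y K` iff `y g y⁻¹ ∈ M_e · K`,
`deckAct_fixes_eMk_iff`).  PROOF-ONLY file (cell abc-iut, layer L3, GAP row G-t6g3-2b, sub-row
T37iii·LOCFIN-PERSIST (B3-L) — the group-theoretic half; abc-iut-L6-t17 g6; no definition):

* `conj_eq_conjBr_mul_of_fixes`, `exists_branchConj_of_fixes_two` — the coset ALGEBRA: if the vertex
  class is `H_u y K` with `y = h · s_β · y₁ · κ` (`h ∈ H_u`, `κ ∈ K`, `K` normal) and `g` fixes the edge class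
  `M_e y₁ K`, then `y g y⁻¹ ∈ (h Π_β h⁻¹) · K`, `Π_β = s_β M_e s_β⁻¹ ≤ H_u`; two fixed edge classes at one
  vertex class put `y g y⁻¹`, modulo `K ∩ H_u`, in the intersection of two conjugated branch subgroups;
* `mem_of_fixes_two_of_ne` — DISTINCT branches `β₁ ≠ β` at `u`, branch subgroups closed and ESTRANGED
  inside the profinite `H_u` (first clause of the tree's `IsEstrangedEdge`), levels `K_k` with `K_k ∩ H_u`
  open normal in `H_u`, antitone, meeting in `1`: there is `k₀` (depending on an open normal `N ≤ Γ`) such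
  that for `k ≥ k₀` with `K_k ≤ N`, an element fixing two edge classes through `β₁`, `β` at one vertex
  class lies in `N` — by `EstrangedUniform.exists_level_of_estranged` (estrangement is UNIFORM at `H_u`);
* `mem_or_fold_of_fixes_two` — the SAME branch `β`, branch subgroup MALNORMAL in `H_u` (second clause of
  `IsEstrangedEdge`), a lower level `j`: for `k ≥ k₀(N, j)` with `K_k ≤ N`, `K_k ≤ K_j`, an element fixing
  two edge classes `M_e y₁ K_k`, `M_e y' K_k` through `β` at one vertex class lies in `N` OR the classes
  FOLD at level `j`: `M_e y' K_j = M_e y₁ K_j` — by `EstrangedUniform.exists_level_of_malnormal`.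

Combined with abc-iut-w5-d212's `TreeSystemUnfoldedFixedSubjoint` / `compactInVerticialAt_of_eventually_noUnfolded`
(binder «eventually no unfolded C-fixed subjoint») and the identification `treeCosetIso` of the canonical
trees with coset graphs (T3d), this is the per-vertex kill behind «no VERTICAL escape at locally finite
vertices» (desk memos LOCFIN-PERSISTENCE Part II (abc-iut-w6-d066) / R1b-DESK §1).  Nothing here asserts
(FIX∞) for any `𝒢`; nothing bears on [IUTchIII] Cor. 3.12.
-/

namespace Literature.AnabelianGeometry.SemiGraphs

namespace SemiGraph

namespace SubgroupPresentation

open scoped Pointwise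
open Set

universe u

variable {𝔾 : SemiGraph.{u}} {Γ : Type u} [Group Γ] (P : SubgroupPresentation 𝔾 Γ)

/-- **Edge-class algebra.**  If `y = h · s_β · y₁ · κ` with `κ ∈ K` (`K` normal) and `y₁ g y₁⁻¹ ∈ M_e · K`
(`e` the edge of `β`), then `y g y⁻¹ = p · κ'` with `p = (h s_β) m (h s_β)⁻¹` for some `m ∈ M_e` and
`κ' ∈ K`. [cite: MochizukiSemiAnbd2006, Thm 3.7(iii) p.41] -/
theorem conj_eq_conjBr_mul_of_fixes (K : Subgroup Γ) [K.Normal] (β : 𝔾.Branch)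
    {g y y₁ h κ : Γ} (hκ : κ ∈ K) (hy : y = h * P.s β * y₁ * κ)
    (hfix : y₁ * g * y₁⁻¹ ∈ ((P.M (𝔾.edgeOf β) : Subgroup Γ) : Set Γ) * (K : Set Γ)) :
    ∃ m ∈ P.M (𝔾.edgeOf β), ∃ κ' ∈ K,
      y * g * y⁻¹ = ((h * P.s β) * m * (h * P.s β)⁻¹) * κ' := by
  obtain ⟨m, hm, k, hk, hmk⟩ := Set.mem_mul.mp hfix
  have hg : g = y₁⁻¹ * (m * k) * y₁ := by rw [hmk]; group
  refine ⟨m, hm, ((h * P.s β) * m * (h * P.s β)⁻¹)⁻¹ * (y * g * y⁻¹), ?_, by group⟩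
  -- the level part: `p⁻¹ (y g y⁻¹) = (h s) · [(m⁻¹ (y₁κy₁⁻¹) m) k (y₁κy₁⁻¹)⁻¹] · (h s)⁻¹ ∈ K`
  have hκ₃ : y₁ * κ * y₁⁻¹ ∈ K := Subgroup.Normal.conj_mem ‹K.Normal› κ hκ y₁
  have hinner : (m⁻¹ * (y₁ * κ * y₁⁻¹) * m) * k * (y₁ * κ * y₁⁻¹)⁻¹ ∈ K := by
    refine K.mul_mem (K.mul_mem ?_ hk) (K.inv_mem hκ₃)
    simpa using Subgroup.Normal.conj_mem ‹K.Normal› _ hκ₃ m⁻¹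
  have hconj := Subgroup.Normal.conj_mem ‹K.Normal› _ hinner (h * P.s β)
  have hid : ((h * P.s β) * m * (h * P.s β)⁻¹)⁻¹ * (y * g * y⁻¹) =
      (h * P.s β) * ((m⁻¹ * (y₁ * κ * y₁⁻¹) * m) * k * (y₁ * κ * y₁⁻¹)⁻¹) * (h * P.s β)⁻¹ := by
    rw [hy, hg]; group
  rw [hid]
  exact hconj

/-- The conjugate `(h s_β) m (h s_β)⁻¹` of an edge-group element lies in the vertex group `H_u` when
`β` abuts to `u` and `h ∈ H_u` (`s_β M_e s_β⁻¹ ≤ H_u`). [cite: MochizukiSemiAnbd2006, Thm 3.7(iii) p.41] -/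
theorem conjBr_mem_H {u : 𝔾.Vertex} (β : 𝔾.Branch) (hu : 𝔾.abuts β = some u) {h m : Γ}
    (hh : h ∈ P.H u) (hm : m ∈ P.M (𝔾.edgeOf β)) : (h * P.s β) * m * (h * P.s β)⁻¹ ∈ P.H u := by
  have h1 : P.s β * m * (P.s β)⁻¹ ∈ P.H u := P.conj_mem β u hu m hm
  have h2 := (P.H u).mul_mem ((P.H u).mul_mem hh h1) ((P.H u).inv_mem hh)
  simpa [mul_assoc] using h2

/-- **Two fixed edge classes at one vertex class** (the input configuration of the local no-escape step):
if `H_u y K` carries the `g`-fixed edge classes `M_{e₁} y₁ K` (through `β₁`, `y = h₁ s_{β₁} y₁ κ₁`) and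
`M_e y' K` (through `β`, `y = h s_β y' κ`), then `y g y⁻¹ = p₁ κ₁' = p κ'` with `p₁ ∈ h₁ Π_{β₁} h₁⁻¹`,
`p ∈ h Π_β h⁻¹` (both in `H_u`), `κ₁', κ' ∈ K`, hence `p⁻¹ p₁ ∈ K ∩ H_u` — the element `p₁` lies in the
`(K ∩ H_u)`-thickened intersection of the two conjugated branch subgroups of `H_u`, which is where
`EstrangedUniform.exists_level_of_estranged` / `…_of_malnormal` (in the profinite group `H_u`) take over.
[cite: MochizukiSemiAnbd2006, Thm 3.7(iii) p.41] -/
theorem exists_branchConj_of_fixes_two (K : Subgroup Γ) [K.Normal] {u : 𝔾.Vertex}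
    (β₁ β : 𝔾.Branch) (hu₁ : 𝔾.abuts β₁ = some u) (hu : 𝔾.abuts β = some u)
    {g y y₁ y' h₁ h κ₁ κ : Γ} (hh₁ : h₁ ∈ P.H u) (hh : h ∈ P.H u) (hκ₁ : κ₁ ∈ K) (hκ : κ ∈ K)
    (hy₁ : y = h₁ * P.s β₁ * y₁ * κ₁) (hy : y = h * P.s β * y' * κ)
    (hfix₁ : y₁ * g * y₁⁻¹ ∈ ((P.M (𝔾.edgeOf β₁) : Subgroup Γ) : Set Γ) * (K : Set Γ))
    (hfix : y' * g * y'⁻¹ ∈ ((P.M (𝔾.edgeOf β) : Subgroup Γ) : Set Γ) * (K : Set Γ)) :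
    ∃ m₁ ∈ P.M (𝔾.edgeOf β₁), ∃ m ∈ P.M (𝔾.edgeOf β), ∃ κ₁' ∈ K, ∃ κ' ∈ K,
      y * g * y⁻¹ = ((h₁ * P.s β₁) * m₁ * (h₁ * P.s β₁)⁻¹) * κ₁' ∧
      y * g * y⁻¹ = ((h * P.s β) * m * (h * P.s β)⁻¹) * κ' ∧
      ((h₁ * P.s β₁) * m₁ * (h₁ * P.s β₁)⁻¹) ∈ P.H u ∧ ((h * P.s β) * m * (h * P.s β)⁻¹) ∈ P.H u ∧
      ((h * P.s β) * m * (h * P.s β)⁻¹)⁻¹ * ((h₁ * P.s β₁) * m₁ * (h₁ * P.s β₁)⁻¹) ∈ K ⊓ P.H u := by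
  obtain ⟨m₁, hm₁, κ₁', hκ₁', e₁⟩ := P.conj_eq_conjBr_mul_of_fixes K β₁ hκ₁ hy₁ hfix₁
  obtain ⟨m, hm, κ', hκ', e⟩ := P.conj_eq_conjBr_mul_of_fixes K β hκ hy hfix
  have hp₁ := P.conjBr_mem_H β₁ hu₁ hh₁ hm₁
  have hp := P.conjBr_mem_H β hu hh hm
  refine ⟨m₁, hm₁, m, hm, κ₁', hκ₁', κ', hκ', e₁, e, hp₁, hp, ?_, ?_⟩
  · -- `p⁻¹ p₁ = κ' κ₁'⁻¹ ∈ K`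
    have : ((h * P.s β) * m * (h * P.s β)⁻¹)⁻¹ * ((h₁ * P.s β₁) * m₁ * (h₁ * P.s β₁)⁻¹) =
        κ' * κ₁'⁻¹ := by
      have e' : (h * P.s β) * m * (h * P.s β)⁻¹ = (y * g * y⁻¹) * κ'⁻¹ := by rw [e]; group
      have e₁' : (h₁ * P.s β₁) * m₁ * (h₁ * P.s β₁)⁻¹ = (y * g * y⁻¹) * κ₁'⁻¹ := by rw [e₁]; group
      rw [e', e₁']; group
    rw [this]
    exact K.mul_mem hκ' (K.inv_mem hκ₁')
  · exact (P.H u).mul_mem ((P.H u).inv_mem hp) hp₁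

/-! ### Step 2: the profinite vertex group — distinct branches are impossible, equal branches fold -/

/-- The conjugate `(h s_β) m (h s_β)⁻¹`, as an element of `H_u`, lies in `h Π_β h⁻¹` (inside `H_u`).
[cite: MochizukiSemiAnbd2006, Thm 3.7(iii) p.41] -/
theorem conjBr_mem_map_brIn {u : 𝔾.Vertex} (β : 𝔾.Branch) (hu : 𝔾.abuts β = some u) {h m : Γ}
    (hh : h ∈ P.H u) (hm : m ∈ P.M (𝔾.edgeOf β)) :
    (⟨(h * P.s β) * m * (h * P.s β)⁻¹, P.conjBr_mem_H β hu hh hm⟩ : P.H u) ∈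
      (((((P.M (𝔾.edgeOf β)).map (MulAut.conj (P.s β)).toMonoidHom).subgroupOf (P.H u))).map (MulAut.conj (⟨h, hh⟩ : P.H u)).toMonoidHom : Subgroup (P.H u)) := by
  refine ⟨⟨P.s β * m * (P.s β)⁻¹, P.conj_mem β u hu m hm⟩, ?_, ?_⟩
  · -- membership in `Π_β` read inside `H_u`
    change (P.s β * m * (P.s β)⁻¹) ∈ ((P.M (𝔾.edgeOf β)).map (MulAut.conj (P.s β)).toMonoidHom)
    exact ⟨m, hm, by simp [MulAut.conj_apply]⟩
  · apply Subtype.ext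
    simp [MulAut.conj_apply, mul_assoc]

variable [TopologicalSpace Γ] [IsTopologicalGroup Γ]

/-- **Distinct branches cannot both be fixed at a deep level** ([SemiAnbd] Thm 3.7 (iii) p. 41, "joined
to one another by a single edge", localised; estranged first clause): for `u` with profinite `H_u`,
branches `β₁ ≠ β` abutting to `u` whose branch subgroups are closed and ESTRANGED in `H_u`, levels
`L k = K_k ∩ H_u` (open normal in `H_u`, antitone, meeting in `1`) and an open normal `N ≤ Γ`: there is
`k₀` such that for `k ≥ k₀` with `K_k ≤ N`, an element `g` fixing two edge classes through `β₁` and `β`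
at one vertex class `H_u y K_k` lies in `N`. [cite: MochizukiSemiAnbd2006, Thm 3.7(iii) p.41] -/
theorem mem_of_fixes_two_of_ne {u : 𝔾.Vertex} [CompactSpace (P.H u)] [TotallyDisconnectedSpace (P.H u)]
    [T2Space (P.H u)] (β₁ β : 𝔾.Branch) (hu₁ : 𝔾.abuts β₁ = some u) (hu : 𝔾.abuts β = some u)
    (hcl₁ : IsClosed ((((P.M (𝔾.edgeOf β₁)).map (MulAut.conj (P.s β₁)).toMonoidHom).subgroupOf (P.H u)) : Set (P.H u))) (hcl : IsClosed ((((P.M (𝔾.edgeOf β)).map (MulAut.conj (P.s β)).toMonoidHom).subgroupOf (P.H u)) : Set (P.H u)))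
    (hest : ∀ γ : P.H u, (((P.M (𝔾.edgeOf β₁)).map (MulAut.conj (P.s β₁)).toMonoidHom).subgroupOf (P.H u)) ⊓ ((((P.M (𝔾.edgeOf β)).map (MulAut.conj (P.s β)).toMonoidHom).subgroupOf (P.H u))).map (MulAut.conj γ).toMonoidHom = ⊥)
    (K : ℕ → Subgroup Γ) [∀ k, (K k).Normal] (L : ℕ → OpenNormalSubgroup (P.H u))
    (hLK : ∀ (k : ℕ) (x : P.H u), x ∈ L k ↔ (x : Γ) ∈ K k) (hL : Antitone L)
    (hinter : ∀ x : P.H u, (∀ k, x ∈ L k) → x = 1)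
    (N : Subgroup Γ) [N.Normal] (hN : IsOpen (N : Set Γ)) :
    ∃ k₀ : ℕ, ∀ k, k₀ ≤ k → K k ≤ N →
      ∀ {g y y₁ y' h₁ h κ₁ κ : Γ}, h₁ ∈ P.H u → h ∈ P.H u → κ₁ ∈ K k → κ ∈ K k →
        y = h₁ * P.s β₁ * y₁ * κ₁ → y = h * P.s β * y' * κ →
        y₁ * g * y₁⁻¹ ∈ ((P.M (𝔾.edgeOf β₁) : Subgroup Γ) : Set Γ) * (K k : Set Γ) →
        y' * g * y'⁻¹ ∈ ((P.M (𝔾.edgeOf β) : Subgroup Γ) : Set Γ) * (K k : Set Γ) → g ∈ N := by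
  -- the open set `N ∩ H_u` of the profinite group `H_u`
  have hMo : IsOpen (Subtype.val ⁻¹' (N : Set Γ) : Set (P.H u)) := hN.preimage continuous_subtype_val
  have hM1 : (1 : P.H u) ∈ (Subtype.val ⁻¹' (N : Set Γ) : Set (P.H u)) := by
    change ((1 : P.H u) : Γ) ∈ (N : Set Γ); simp [N.one_mem]
  obtain ⟨k₀, hk₀⟩ := EstrangedUniform.exists_level_of_estranged ((((P.M (𝔾.edgeOf β₁)).map (MulAut.conj (P.s β₁)).toMonoidHom).subgroupOf (P.H u))) ((((P.M (𝔾.edgeOf β)).map (MulAut.conj (P.s β)).toMonoidHom).subgroupOf (P.H u))) hcl₁ hcl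
    hest L hL hinter _ hMo hM1
  refine ⟨k₀, fun k hk hKN g y y₁ y' h₁ h κ₁ κ hh₁ hh hκ₁ hκ hy₁ hy hfix₁ hfix => ?_⟩
  obtain ⟨m₁, hm₁, m, hm, κ₁', hκ₁', κ', hκ', e₁, e, hp₁, hp, hquot, -⟩ :=
    P.exists_branchConj_of_fixes_two (K k) β₁ β hu₁ hu hh₁ hh hκ₁ hκ hy₁ hy hfix₁ hfix
  -- the two elements of `H_u`: `p₁ ∈ (h₁ Π_{β₁} h₁⁻¹) · L k` and `p₁ = p · (p⁻¹ p₁)` with `p⁻¹ p₁ ∈ L k`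
  have hP₁ : (⟨(h₁ * P.s β₁) * m₁ * (h₁ * P.s β₁)⁻¹, hp₁⟩ : P.H u) ∈
      ((((((P.M (𝔾.edgeOf β₁)).map (MulAut.conj (P.s β₁)).toMonoidHom).subgroupOf (P.H u))).map (MulAut.conj (⟨h₁, hh₁⟩ : P.H u)).toMonoidHom : Subgroup (P.H u)) :
        Set (P.H u)) * (L k : Set (P.H u)) := by
    have h1 : (1 : P.H u) ∈ (L k : Set (P.H u)) := (L k).one_mem
    have hmul := Set.mul_mem_mul (P.conjBr_mem_map_brIn β₁ hu₁ hh₁ hm₁) h1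
    rwa [mul_one] at hmul
  have hquot' : (⟨(h * P.s β) * m * (h * P.s β)⁻¹, hp⟩ : P.H u)⁻¹ *
      ⟨(h₁ * P.s β₁) * m₁ * (h₁ * P.s β₁)⁻¹, hp₁⟩ ∈ L k := by
    rw [hLK]
    exact hquot
  have hP₁' : (⟨(h₁ * P.s β₁) * m₁ * (h₁ * P.s β₁)⁻¹, hp₁⟩ : P.H u) ∈
      ((((((P.M (𝔾.edgeOf β)).map (MulAut.conj (P.s β)).toMonoidHom).subgroupOf (P.H u))).map (MulAut.conj (⟨h, hh⟩ : P.H u)).toMonoidHom : Subgroup (P.H u)) :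
        Set (P.H u)) * (L k : Set (P.H u)) := by
    have hsplit : (⟨(h₁ * P.s β₁) * m₁ * (h₁ * P.s β₁)⁻¹, hp₁⟩ : P.H u) =
        ⟨(h * P.s β) * m * (h * P.s β)⁻¹, hp⟩ *
          ((⟨(h * P.s β) * m * (h * P.s β)⁻¹, hp⟩ : P.H u)⁻¹ *
            ⟨(h₁ * P.s β₁) * m₁ * (h₁ * P.s β₁)⁻¹, hp₁⟩) := by group
    rw [hsplit]
    exact Set.mul_mem_mul (P.conjBr_mem_map_brIn β hu hh hm) hquot'
  have hmem := hk₀ k hk ⟨h₁, hh₁⟩ ⟨h, hh⟩ ⟨hP₁, hP₁'⟩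
  -- `p₁ ∈ N`, hence `y g y⁻¹ = p₁ κ₁' ∈ N`, hence `g ∈ N`
  have hp₁N : (h₁ * P.s β₁) * m₁ * (h₁ * P.s β₁)⁻¹ ∈ N := hmem
  have hygy : y * g * y⁻¹ ∈ N := by rw [e₁]; exact N.mul_mem hp₁N (hKN hκ₁')
  have := Subgroup.Normal.conj_mem ‹N.Normal› _ hygy y⁻¹
  simpa [mul_assoc] using this

/-- **Equal branches fold at a deep level** ([SemiAnbd] Thm 3.7 (iii) p. 41 / Comments (2020) (6)(b)
"each of the sets `E_{j,i}`, for `i` sufficiently large relative to `j`, is of cardinality 1", localised;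
estranged second clause = malnormality): for `u` with profinite `H_u`, a branch `β` abutting to `u` whose
branch subgroup is closed and MALNORMAL in `H_u`, levels `L k = K_k ∩ H_u` as above, an open normal
`N ≤ Γ` and a lower level `j`: there is `k₀` such that for `k ≥ k₀` with `K_k ≤ N` and `K_k ≤ K_j`, if `g`
fixes two edge classes `M_e y₁ K_k`, `M_e y' K_k` through `β` at one vertex class `H_u y K_k`, then EITHER
`g ∈ N` OR the two edge classes have the same image at level `j`: `M_e y' K_j = M_e y₁ K_j`.
[cite: MochizukiSemiAnbd2006, Thm 3.7(iii) p.41] -/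
theorem mem_or_fold_of_fixes_two {u : 𝔾.Vertex} [CompactSpace (P.H u)] [TotallyDisconnectedSpace (P.H u)]
    [T2Space (P.H u)] (β : 𝔾.Branch) (hu : 𝔾.abuts β = some u)
    (hcl : IsClosed ((((P.M (𝔾.edgeOf β)).map (MulAut.conj (P.s β)).toMonoidHom).subgroupOf (P.H u)) : Set (P.H u)))
    (hmal : ∀ γ : P.H u, γ ∉ (((P.M (𝔾.edgeOf β)).map (MulAut.conj (P.s β)).toMonoidHom).subgroupOf (P.H u)) →
      (((P.M (𝔾.edgeOf β)).map (MulAut.conj (P.s β)).toMonoidHom).subgroupOf (P.H u)) ⊓ ((((P.M (𝔾.edgeOf β)).map (MulAut.conj (P.s β)).toMonoidHom).subgroupOf (P.H u))).map (MulAut.conj γ).toMonoidHom = ⊥)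
    (K : ℕ → Subgroup Γ) [∀ k, (K k).Normal] (L : ℕ → OpenNormalSubgroup (P.H u))
    (hLK : ∀ (k : ℕ) (x : P.H u), x ∈ L k ↔ (x : Γ) ∈ K k) (hL : Antitone L)
    (hinter : ∀ x : P.H u, (∀ k, x ∈ L k) → x = 1)
    (N : Subgroup Γ) [N.Normal] (hN : IsOpen (N : Set Γ)) (j : ℕ) :
    ∃ k₀ : ℕ, ∀ k, k₀ ≤ k → K k ≤ N → K k ≤ K j →
      ∀ {g y y₁ y' h₁ h κ₁ κ : Γ}, h₁ ∈ P.H u → h ∈ P.H u → κ₁ ∈ K k → κ ∈ K k →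
        y = h₁ * P.s β * y₁ * κ₁ → y = h * P.s β * y' * κ →
        y₁ * g * y₁⁻¹ ∈ ((P.M (𝔾.edgeOf β) : Subgroup Γ) : Set Γ) * (K k : Set Γ) →
        y' * g * y'⁻¹ ∈ ((P.M (𝔾.edgeOf β) : Subgroup Γ) : Set Γ) * (K k : Set Γ) →
        g ∈ N ∨ DoubleCoset.mk (P.M (𝔾.edgeOf β)) (K j) y' = DoubleCoset.mk (P.M (𝔾.edgeOf β)) (K j) y₁ := by
  have hMo : IsOpen (Subtype.val ⁻¹' (N : Set Γ) : Set (P.H u)) := hN.preimage continuous_subtype_val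
  have hM1 : (1 : P.H u) ∈ (Subtype.val ⁻¹' (N : Set Γ) : Set (P.H u)) := by
    change ((1 : P.H u) : Γ) ∈ (N : Set Γ); simp [N.one_mem]
  obtain ⟨k₀, hk₀⟩ := EstrangedUniform.exists_level_of_malnormal ((((P.M (𝔾.edgeOf β)).map (MulAut.conj (P.s β)).toMonoidHom).subgroupOf (P.H u))) hcl hmal L hL hinter _
    hMo hM1 (L j : Set (P.H u)) (L j).toOpenSubgroup.isOpen (L j).one_mem
  refine ⟨k₀, fun k hk hKN hKj g y y₁ y' h₁ h κ₁ κ hh₁ hh hκ₁ hκ hy₁ hy hfix₁ hfix => ?_⟩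
  obtain ⟨m₁, hm₁, m, hm, κ₁', hκ₁', κ', hκ', e₁, e, hp₁, hp, hquot, -⟩ :=
    P.exists_branchConj_of_fixes_two (K k) β β hu hu hh₁ hh hκ₁ hκ hy₁ hy hfix₁ hfix
  by_cases hfold : (⟨h₁, hh₁⟩ : P.H u)⁻¹ * ⟨h, hh⟩ ∈
      ((((P.M (𝔾.edgeOf β)).map (MulAut.conj (P.s β)).toMonoidHom).subgroupOf (P.H u)) : Set (P.H u)) * (L j : Set (P.H u))
  · -- FOLDING: `h₁⁻¹ h = (s m₀ s⁻¹) · l` with `m₀ ∈ M_e`, `l ∈ K_j`, whence `y₁ ∈ M_e · y' · K_j`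
    right
    obtain ⟨π, hπ, l, hl, hprod⟩ := Set.mem_mul.mp hfold
    obtain ⟨m₀, hm₀, hm₀eq⟩ := hπ
    have hπval : (π : Γ) = P.s β * m₀ * (P.s β)⁻¹ := by
      have hm := hm₀eq
      simp only [MulEquiv.coe_toMonoidHom, MulAut.conj_apply, Subgroup.coe_subtype] at hm
      exact hm.symm
    have hlK : (l : Γ) ∈ K j := (hLK j l).mp hl
    have hval : (π : Γ) * (l : Γ) = h₁⁻¹ * h := by
      have := congrArg Subtype.val hprod
      simpa using this
    -- the level-`j` witness
    have hk'' : y'⁻¹ * ((P.s β)⁻¹ * (l : Γ) * P.s β) * y' * (κ * κ₁⁻¹) ∈ K j := by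
      have h1 : (P.s β)⁻¹ * (l : Γ) * P.s β ∈ K j := by
        simpa using Subgroup.Normal.conj_mem inferInstance (l : Γ) hlK (P.s β)⁻¹
      have h2 : y'⁻¹ * ((P.s β)⁻¹ * (l : Γ) * P.s β) * y' ∈ K j := by
        simpa using Subgroup.Normal.conj_mem inferInstance _ h1 y'⁻¹
      exact (K j).mul_mem h2 (hKj ((K k).mul_mem hκ (((K k).inv_mem hκ₁))))
    refine DoubleCoset.eq _ _ _ _ |>.mpr ⟨m₀, hm₀, _, hk'', ?_⟩
    -- `y₁ = m₀ · y' · k''`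
    have hy₁' : y₁ = (P.s β)⁻¹ * (h₁⁻¹ * h) * P.s β * y' * κ * κ₁⁻¹ := by
      have := hy₁.symm.trans hy
      -- `h₁ s y₁ κ₁ = h s y' κ`
      calc y₁ = (P.s β)⁻¹ * h₁⁻¹ * (h₁ * P.s β * y₁ * κ₁) * κ₁⁻¹ := by group
        _ = (P.s β)⁻¹ * h₁⁻¹ * (h * P.s β * y' * κ) * κ₁⁻¹ := by rw [this]
        _ = _ := by group
    rw [hy₁', ← hval, hπval]
    group
  · -- NO FOLDING: the same-branch clause of Lemma E puts `p₁` in `N`, hence `g ∈ N`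
    left
    have hP₁ : (⟨(h₁ * P.s β) * m₁ * (h₁ * P.s β)⁻¹, hp₁⟩ : P.H u) ∈
        ((((((P.M (𝔾.edgeOf β)).map (MulAut.conj (P.s β)).toMonoidHom).subgroupOf (P.H u))).map (MulAut.conj (⟨h₁, hh₁⟩ : P.H u)).toMonoidHom : Subgroup (P.H u)) :
          Set (P.H u)) * (L k : Set (P.H u)) := by
      have h1 : (1 : P.H u) ∈ (L k : Set (P.H u)) := (L k).one_mem
      have hmul := Set.mul_mem_mul (P.conjBr_mem_map_brIn β hu hh₁ hm₁) h1
      rwa [mul_one] at hmul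
    have hquot' : (⟨(h * P.s β) * m * (h * P.s β)⁻¹, hp⟩ : P.H u)⁻¹ *
        ⟨(h₁ * P.s β) * m₁ * (h₁ * P.s β)⁻¹, hp₁⟩ ∈ L k := by
      rw [hLK]
      exact hquot
    have hP₁' : (⟨(h₁ * P.s β) * m₁ * (h₁ * P.s β)⁻¹, hp₁⟩ : P.H u) ∈
        ((((((P.M (𝔾.edgeOf β)).map (MulAut.conj (P.s β)).toMonoidHom).subgroupOf (P.H u))).map (MulAut.conj (⟨h, hh⟩ : P.H u)).toMonoidHom : Subgroup (P.H u)) :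
          Set (P.H u)) * (L k : Set (P.H u)) := by
      have hsplit : (⟨(h₁ * P.s β) * m₁ * (h₁ * P.s β)⁻¹, hp₁⟩ : P.H u) =
          ⟨(h * P.s β) * m * (h * P.s β)⁻¹, hp⟩ *
            ((⟨(h * P.s β) * m * (h * P.s β)⁻¹, hp⟩ : P.H u)⁻¹ *
              ⟨(h₁ * P.s β) * m₁ * (h₁ * P.s β)⁻¹, hp₁⟩) := by group
      rw [hsplit]
      exact Set.mul_mem_mul (P.conjBr_mem_map_brIn β hu hh hm) hquot'
    have hmem := hk₀ k hk ⟨h₁, hh₁⟩ ⟨h, hh⟩ hfold ⟨hP₁, hP₁'⟩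
    have hp₁N : (h₁ * P.s β) * m₁ * (h₁ * P.s β)⁻¹ ∈ N := hmem
    have hygy : y * g * y⁻¹ ∈ N := by rw [e₁]; exact N.mul_mem hp₁N (hKN hκ₁')
    have := Subgroup.Normal.conj_mem ‹N.Normal› _ hygy y⁻¹
    simpa [mul_assoc] using this

end SubgroupPresentation

end SemiGraph

end Literature.AnabelianGeometry.SemiGraphs
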